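import Literature.NumberTheory.EllipticCurves.Rank1Residual.Typed.KolyvaginCertificate
import Literature.NumberTheory.EllipticCurves.Jetchev2008.HeegnerIndexTamagawaBound
import Literature.NumberTheory.EllipticCurves.BSDRootNumberSmallConductorProofs
import Literature.NumberTheory.EllipticCurves.Wuthrich2014.ShaBoundProofs
import HarnessLib

/-!
# The Jetchev certificate `ord_p [E(K) : ℤ y_K] ≤ ord_p c_q`: `Ш(E/ℚ)[p] = 0` and `BSD(E,p)` at the `p ∣ Tamagawa` pairs

HONEST FRAMING (cell `b2b-bsdres`, run/shared/lean/b2b/bsd-rank1-residual/, verbatim in every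
file): the goal of the cell is to DELETE the COMBINATION-SHAPED residual classes of the
Birch–Swinnerton-Dyer formula for ALL analytic-rank `≤ 1` elliptic curves over `ℚ` — "full BSD
formula for every rank `≤ 1` curve in class `C`" assembled STRICTLY from published theorems — so
that the rank-`≤ 1` remainder becomes exactly the CONSTRUCTION-SHAPED classes, which are TYPED
(missing-input `Prop`s), NOT attempted. This is not "finishing BSD". Theorems only (no definition,
no new named fact); PER PAIR; nothing is booked here (the `Ш`-census lane `b2b-bsdres-sha-2` asked
for this consumer, INBOX 2026-08-21T17:39Z item (3)(i); the referee books).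

## What this file proves

The lane's two existing per-pair routes to `Ш(E/ℚ)[p] = 0` in analytic rank one are the
Kolyvagin index certificate `p ∤ [E(K) : ℤ y_K]` (`Typed.bsdp_of_kolyvagin_of_not_dvd_index`,
McCallum 1991 §1) and its irreducible-image form (`Typed.bsdp_of_matarNekovar_of_not_dvd_index`,
Matar–Nekovář 2019 Thm. 6.7 (1)). Both are EMPTY at a pair where `p` divides a Tamagawa number of
`E`: the Gross–Zagier form of BSD over `K` predicts `ord_p [E(K) : ℤ y_K] ≥ ord_p ∏_q c_q > 0`
there. Jetchev's sharpening (Compos. Math. 144 (2008) Thm. 1.4 / Cor. 1.5, the tree's PUBLISHED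
named fact `Jetchev2008.cor15_padicValNat_card_primaryComponent_sha_le`, vendored in the monotone
form "for every prime `q ∣ N`: `ord_p #Ш(E/K)[p^∞] + 2·ord_p c_q ≤ 2·ord_p [E(K) : ℤ y_K]`" under
Hypothesis (\*) — `p` odd, `p ∤ N`, `ρ̄_{E,p}` surjective — for an OPTIMAL `E`, `K = ℚ(√-D)`
Heegner with `d_K ≠ -3`, `y_K` of infinite order) subtracts the largest Tamagawa valuation, so
the certificate becomes

  `ord_p [E(K) : ℤ y_K] ≤ ord_p c_q(E)` for ONE prime `q ∣ N`

(equality is what BSD predicts when exactly one Tamagawa number is divisible by `p`, once, and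
`Ш(E/K)[p] = 0` — Jetchev's "In particular, if `p` divides at most one Tamagawa number, the above
upper bound coincides with the exact upper bound … predicted by the Birch and Swinnerton-Dyer
conjectural formula"). This file records, as compositions of tree theorems BY NAME:

* `padicValNat_card_shaPrimary_baseChange_eq_zero_of_jetchev_of_index_le_tamagawa` —
  the certificate gives `ord_p #Ш(E/K)[p^∞] = 0` (arithmetic on the fact's inequality);
* `noPTorsion_of_jetchev_of_index_le_tamagawa` — hence `Ш(E/ℚ)[p] = 0`: `Ш(E/K)` is finite
  (Kolyvagin's qualitative theorem, named fact `kolyvagin N W K`), so `p ∤ #Ш(E/K)`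
  (`padicValNat_card_addPrimaryComponent`), no element of `Ш(E/K)` has order `p`, and the
  restriction `Ш(E/ℚ) → Ш(E/K)` is injective on `Ш(E/ℚ)[p]` for `p` prime to `[K : ℚ] = 2`
  (`injOn_shaRestriction_torsionBy`) — the argument of `Typed.noPTorsion_of_kolyvagin_of_not_dvd_index`
  verbatim with Jetchev's bound in place of Kolyvagin's;
* `bsdp_of_jetchev_of_index_le_tamagawa` — with Gross–Zagier–Kolyvagin (`hGZK`), analytic rank
  `≤ 1` and `ord_p #Ш(E/ℚ)_an = 0`, Miller's `BSD(E,p)` (`Typed.bsdp_of_shaAn_unit_of_noPTorsion`);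
* `bsdp_of_jetchev_of_index_eq_tamagawa` — the same with the certificate as the EQUALITY the lane
  measures (`m_0(D) = m_max`, sha-2 `gen15/x411/MEASURE-411.md`).

All inputs are PUBLISHED named facts of the tree entering as explicit hypotheses (`hJ` Jetchev 2008
Cor. 1.5; `hKo` Kolyvagin 1990 via Gross 1991 Thm. 1.3; `hGZK` Gross–Zagier–Kolyvagin) plus the
per-pair certificate data (the Heegner field `K`, the optimal model `W` with its optimality datum,
the Heegner point `P = y_K`, the primes `p`, `q`, the two valuations, `#Ш_an`). Unlike
`Rank1Residual.bsdp_of_jetchev_of_twist` (X10-AUDIT §9, file `Rank1Residual/X10RankOne.lean`), no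
model of the twist `E^{(d_K)}` and no `BSD(E^{(d_K)},p)` is needed: at `B = 0` the `K`-level bound
alone kills `Ш(E/K)[p^∞]`. Census pointer (the lane's, not a booking): sha-2 GEN 15 reports 84
`p ∣ Tam` pairs with `m_0(D) = m_max` measured on two engines (`HOME/b2b-bsdres-sha-2/gen15/x411/
jetchev_candidates.json`); whether each meets Hypothesis (\*), optimality and `d_K ≠ -3` is the
lane's row check, and the booking is the referee's. For a non-optimal curve `W'` of the class,
`BSDp W' p` follows from `BSDp W p` by Cassels' isogeny invariance
(`Summit.…Rank1ResidualX1Isogeny.bsdp_iff_of_isIsogenous`, analytic rank `≤ 1`), outside this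
Literature file.

References: D. Jetchev, *Global divisibility of Heegner points and Tamagawa numbers*, Compos.
Math. 144 (2008) 811–826, Hypothesis (\*), Thm. 1.4, Cor. 1.5 (p. 3) [Jetchev2008]; B. H. Gross,
*Kolyvagin's work on modular elliptic curves*, LMS LN 153 (1991) Thm. 1.3 [GrossLMS1991]; W. G.
McCallum, same volume, §1 [McCallumLMS1991]; J.-P. Serre, *Galois Cohomology* I.§2.4
[SerreGaloisCohomology1997]; R. L. Miller, LMS J. Comput. Math. 14 (2011) §1, Def. 1.1
[Miller2011LMS]; cell files `HOME/b2b-bsdres-sha-2/gen15/x411/MEASURE-411.md`, SHA-CENSUS §4k.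
-/

noncomputable section

open scoped Classical

open WeierstrassCurve Literature.NumberTheory.EllipticCurves
  Literature.NumberTheory.EllipticCurves.ModularForms

namespace Literature.NumberTheory.EllipticCurves.Rank1Residual.Typed

open Literature.NumberTheory.EllipticCurves.Rank1Residual

variable (W : WeierstrassCurve ℚ) [W.IsElliptic] (p : ℕ) [Fact p.Prime]

/-- **The Jetchev certificate kills `Ш(E/K)[p^∞]`.** For an optimal `E/ℚ` (model `W`, optimality
datum `hopt`), a Heegner field `K` (`d_K ≠ -3`, Heegner hypothesis for the level `N`), the Heegner
point `P = y_K` of infinite order, an odd prime `p ∤ N` with `ρ̄_{E,p}` surjective (Hypothesis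
(\*)) and a prime `q ∣ N` with `ord_p [E(K) : ℤ y_K] ≤ ord_p c_q(E)`: granted the PUBLISHED named
fact `hJ` (Jetchev 2008 Cor. 1.5: `ord_p #Ш(E/K)[p^∞] + 2·ord_p c_q ≤ 2·ord_p [E(K) : ℤ y_K]`),
`ord_p #Ш(E/K)[p^∞] = 0`. [cite: Jetchev2008, Thm. 1.4 and Cor. 1.5 (p. 3)] -/
theorem padicValNat_card_shaPrimary_baseChange_eq_zero_of_jetchev_of_index_le_tamagawa
    (hJ : Jetchev2008.cor15_padicValNat_card_primaryComponent_sha_le)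
    {N : ℕ} [NeZero N] {K : Type} [Field K] [NumberField K]
    (hK : IsImaginaryQuadratic K) (hD3 : NumberField.discr K ≠ -3)
    (hH : SatisfiesHeegnerHypothesis N K)
    (hopt : ∃ Dt : ModularParametrizationData W N,
      ∀ z ∈ Dt.L.lattice, ∃ w ∈ periodLattice Dt.f, z = (Dt.c : ℂ) * w)
    {P : (W.baseChange K).toAffine.Point} (hP : IsHeegnerPoint N W K P) (hnt : ¬ IsOfFinAddOrder P)
    (hp2 : p ≠ 2) (hpN : ¬ p ∣ N) (hρ : W.HasSurjectiveModNGaloisRep p)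
    (q : ℕ) [Fact q.Prime] (hqN : q ∣ N)
    (hle : padicValNat p (AddSubgroup.zmultiples P).index ≤
      padicValNat p ((W.baseChange ℚ_[q]).localTamagawaNumber ℤ_[q])) :
    padicValNat p (Nat.card (AddCommGroup.primaryComponent (W.baseChange K).sha p)) = 0 := by
  have hb := hJ N W K hK hD3 hH hopt hP hnt p hp2 hpN hρ q hqN
  omega

/-- **The Jetchev certificate gives `Ш(E/ℚ)[p] = 0`.** Same data; in addition the PUBLISHED named
fact `hKo` (`kolyvagin N W K`: `y_K` of infinite order ⇒ `Ш(E/K)` finite, Kolyvagin 1990 / Gross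
1991 Thm. 1.3). Then `p ∤ #Ш(E/K)` (`ord_p #Ш(E/K)[p^∞] = ord_p #Ш(E/K)` for finite `Ш`), no element
of `Ш(E/K)` has order `p`, and the restriction `Ш(E/ℚ) → Ш(E/K)` is injective on `Ш(E/ℚ)[p]`
since `p` is prime to `[K : ℚ] = 2`; so every `p`-torsion class of `Ш(E/ℚ)` vanishes. (The
argument of `noPTorsion_of_kolyvagin_of_not_dvd_index` with Jetchev's bound.)
[cite: Jetchev2008, Cor. 1.5 (p. 3)] [cite: GrossLMS1991, §1 Thm. 1.3 (2), p. 236]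
[cite: SerreGaloisCohomology1997, I.§2.4 Cor. to Prop. 9] -/
theorem noPTorsion_of_jetchev_of_index_le_tamagawa
    (hJ : Jetchev2008.cor15_padicValNat_card_primaryComponent_sha_le)
    {N : ℕ} [NeZero N] {K : Type} [Field K] [NumberField K] (hKo : kolyvagin N W K)
    (hK : IsImaginaryQuadratic K) (hD3 : NumberField.discr K ≠ -3)
    (hH : SatisfiesHeegnerHypothesis N K)
    (hopt : ∃ Dt : ModularParametrizationData W N,
      ∀ z ∈ Dt.L.lattice, ∃ w ∈ periodLattice Dt.f, z = (Dt.c : ℂ) * w)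
    {P : (W.baseChange K).toAffine.Point} (hP : IsHeegnerPoint N W K P) (hnt : ¬ IsOfFinAddOrder P)
    (hp2 : p ≠ 2) (hpN : ¬ p ∣ N) (hρ : W.HasSurjectiveModNGaloisRep p)
    (q : ℕ) [Fact q.Prime] (hqN : q ∣ N)
    (hle : padicValNat p (AddSubgroup.zmultiples P).index ≤
      padicValNat p ((W.baseChange ℚ_[q]).localTamagawaNumber ℤ_[q])) :
    ∀ x : W.sha, (p : ℤ) • x = 0 → x = 0 := by
  have hp : p.Prime := Fact.out
  obtain ⟨-, hfinK⟩ := hKo hK hH hP hnt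
  haveI : Finite (W.baseChange K).sha := hfinK
  have h0 : padicValNat p (Nat.card (W.baseChange K).sha) = 0 := by
    rw [← padicValNat_card_addPrimaryComponent (A := (W.baseChange K).sha) p]
    exact padicValNat_card_shaPrimary_baseChange_eq_zero_of_jetchev_of_index_le_tamagawa W p hJ hK
      hD3 hH hopt hP hnt hp2 hpN hρ q hqN hle
  have hndvd : ¬ p ∣ Nat.card (W.baseChange K).sha := by
    rcases padicValNat.eq_zero_iff.mp h0 with h1 | h0' | hnd
    · exact absurd h1 hp.one_lt.ne'
    · exact absurd h0' Nat.card_pos.ne'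
    · exact hnd
  haveI : IsGalois ℚ K := by
    haveI : Algebra.IsQuadraticExtension ℚ K := ⟨hK.1⟩
    infer_instance
  have hcop : p.Coprime (Module.finrank ℚ K) := by
    rw [hK.1]
    exact (Nat.coprime_primes hp Nat.prime_two).mpr hp2
  intro x hx
  have hxn : p • x = 0 := by rw [← natCast_zsmul]; exact hx
  -- the restriction of `x` is killed by `p` in a finite group of order prime to `p`, hence is `0`
  have hres : shaRestriction W K x = 0 := by
    have hpr : p • shaRestriction W K x = 0 := by rw [← map_nsmul, hxn, map_zero]
    have hdiv : addOrderOf (shaRestriction W K x) ∣ p := addOrderOf_dvd_of_nsmul_eq_zero hpr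
    rcases (Nat.dvd_prime hp).mp hdiv with h1 | hp'
    · exact AddMonoid.addOrderOf_eq_one_iff.mp h1
    · exact absurd (hp' ▸ addOrderOf_dvd_natCard (shaRestriction W K x)) hndvd
  -- injectivity of restriction on `Ш(E/ℚ)[p]`
  have hx_mem : x ∈ (AddSubgroup.torsionBy W.sha p : Set W.sha) :=
    AddSubgroup.torsionBy.nsmul_iff.mpr hxn
  have h0_mem : (0 : W.sha) ∈ (AddSubgroup.torsionBy W.sha p : Set W.sha) :=
    AddSubgroup.torsionBy.nsmul_iff.mpr (smul_zero _)
  exact injOn_shaRestriction_torsionBy W K hcop hx_mem h0_mem (by rw [hres, map_zero])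

/-- **`BSD(E,p)` from the Jetchev certificate at a pair with `ord_p #Ш_an = 0`** (analytic rank
`≤ 1`): PUBLISHED named facts `hJ` (Jetchev 2008 Cor. 1.5), `hKo` (`Ш(E/K)` finite) and `hGZK`
(`rank = r_an`, `Ш(E/ℚ)` finite); the certificate is the optimal model `W` (`hopt`), the Heegner
field `K` (`d_K ≠ -3`, Heegner hypothesis for `N`), the Heegner point `P` of infinite order, an odd
good prime `p ∤ N` with `ρ̄_{E,p}` onto, ONE prime `q ∣ N` with `ord_p [E(K) : ℤ P] ≤ ord_p c_q(E)`,
and `#Ш_an` a `p`-adic unit. The `p ∣ Tamagawa` companion of `bsdp_of_kolyvagin_of_not_dvd_index`.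
Per pair; not a class theorem. [cite: Jetchev2008, Cor. 1.5 (p. 3)]
[cite: Miller2011LMS, §1 and Def. 1.1] -/
theorem bsdp_of_jetchev_of_index_le_tamagawa
    (hJ : Jetchev2008.cor15_padicValNat_card_primaryComponent_sha_le)
    (hGZK : rank_eq_analyticRank_of_analyticRank_le_one)
    {N : ℕ} [NeZero N] {K : Type} [Field K] [NumberField K] (hKo : kolyvagin N W K)
    (hK : IsImaginaryQuadratic K) (hD3 : NumberField.discr K ≠ -3)
    (hH : SatisfiesHeegnerHypothesis N K)
    (hopt : ∃ Dt : ModularParametrizationData W N,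
      ∀ z ∈ Dt.L.lattice, ∃ w ∈ periodLattice Dt.f, z = (Dt.c : ℂ) * w)
    {P : (W.baseChange K).toAffine.Point} (hP : IsHeegnerPoint N W K P) (hnt : ¬ IsOfFinAddOrder P)
    (hp2 : p ≠ 2) (hpN : ¬ p ∣ N) (hρ : W.HasSurjectiveModNGaloisRep p)
    (q : ℕ) [Fact q.Prime] (hqN : q ∣ N)
    (hle : padicValNat p (AddSubgroup.zmultiples P).index ≤
      padicValNat p ((W.baseChange ℚ_[q]).localTamagawaNumber ℤ_[q]))
    (hr : W.analyticRank ≤ 1) {s : ℚ} (hs : shaAn W = (s : ℂ)) (hv : padicValRat p s = 0) :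
    BSDp W p :=
  bsdp_of_shaAn_unit_of_noPTorsion W p hGZK hr hs hv
    (noPTorsion_of_jetchev_of_index_le_tamagawa W p hJ hKo hK hD3 hH hopt hP hnt hp2 hpN hρ q hqN hle)

/-- **The lane's measured form**: the certificate as the EQUALITY `ord_p [E(K) : ℤ y_K] = ord_p c_q(E)`
(sha-2's `m_0(D) = m_max`, the prime `q ∣ N` realising the maximum; Jetchev's sharp case "`p`
divides at most one Tamagawa number"). [cite: Jetchev2008, Cor. 1.5 (p. 3)]
[cite: Miller2011LMS, §1 and Def. 1.1] -/
theorem bsdp_of_jetchev_of_index_eq_tamagawa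
    (hJ : Jetchev2008.cor15_padicValNat_card_primaryComponent_sha_le)
    (hGZK : rank_eq_analyticRank_of_analyticRank_le_one)
    {N : ℕ} [NeZero N] {K : Type} [Field K] [NumberField K] (hKo : kolyvagin N W K)
    (hK : IsImaginaryQuadratic K) (hD3 : NumberField.discr K ≠ -3)
    (hH : SatisfiesHeegnerHypothesis N K)
    (hopt : ∃ Dt : ModularParametrizationData W N,
      ∀ z ∈ Dt.L.lattice, ∃ w ∈ periodLattice Dt.f, z = (Dt.c : ℂ) * w)
    {P : (W.baseChange K).toAffine.Point} (hP : IsHeegnerPoint N W K P) (hnt : ¬ IsOfFinAddOrder P)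
    (hp2 : p ≠ 2) (hpN : ¬ p ∣ N) (hρ : W.HasSurjectiveModNGaloisRep p)
    (q : ℕ) [Fact q.Prime] (hqN : q ∣ N)
    (heq : padicValNat p (AddSubgroup.zmultiples P).index =
      padicValNat p ((W.baseChange ℚ_[q]).localTamagawaNumber ℤ_[q]))
    (hr : W.analyticRank ≤ 1) {s : ℚ} (hs : shaAn W = (s : ℂ)) (hv : padicValRat p s = 0) :
    BSDp W p :=
  bsdp_of_jetchev_of_index_le_tamagawa W p hJ hGZK hKo hK hD3 hH hopt hP hnt hp2 hpN hρ q hqN heq.le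
    hr hs hv

/-! ### Appendix (x1b GEN 28, same day): the class form — a non-optimal curve of the isogeny class

The fact's optimality binder `hopt` restricts the certificate to the OPTIMAL curve `W'` of the class;
`BSD(E,p)` of any `ℚ`-isogenous globally minimal `W` then follows by Cassels' isogeny invariance of
the BSD quotient (named fact `hCassels`; tree theorem `Wuthrich2014.bsdp_of_isIsogenous`) together
with modularity (`hmod`, for `L^{(r)}(W',1)/r! ≠ 0`) and GZK (finiteness of `Ш(W')`), exactly as in
`Summit.…Rank1ResidualX1Isogeny.bsdp_iff_of_isIsogenous`. -/

/-- **Class form of the Jetchev certificate**: `W ∼ W'` (`ℚ`-isogenous, both globally minimal), the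
certificate of `bsdp_of_jetchev_of_index_le_tamagawa` read on the OPTIMAL curve `W'` (Heegner field
`K`, Heegner point `P ∈ W'(K)` of infinite order, `p ∤ N` odd with `ρ̄_{W',p}` onto, a prime `q ∣ N`
with `ord_p [W'(K) : ℤ P] ≤ ord_p c_q(W')`, `ord_p #Ш(W')_an = 0`, `r_an(W') ≤ 1`) ⇒ `BSD(W,p)`.
Named facts: Jetchev 2008 Cor. 1.5 (`hJ`), Kolyvagin (`hKo`), GZK (`hGZK`), modularity (`hmod`),
Cassels (`hCassels`) — all PUBLISHED. Per class; not a class-level theorem of any residual class.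
[cite: Jetchev2008, Cor. 1.5 (p. 3)] [cite: MilneADT2006, Thm. I.7.3 and Remark I.7.4]
[cite: Miller2011LMS, §1 and Def. 1.1] -/
theorem bsdp_of_isIsogenous_of_jetchev_of_index_le_tamagawa
    (hJ : Jetchev2008.cor15_padicValNat_card_primaryComponent_sha_le)
    (hGZK : rank_eq_analyticRank_of_analyticRank_le_one)
    (hmod : hasEntireLFunction_rat) (hCassels : bsdRHS_eq_of_isIsogenous)
    [W.IsGloballyMinimal] (W' : WeierstrassCurve ℚ) [W'.IsElliptic] [W'.IsGloballyMinimal]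
    (hiso : IsIsogenous W W')
    {N : ℕ} [NeZero N] {K : Type} [Field K] [NumberField K] (hKo : kolyvagin N W' K)
    (hK : IsImaginaryQuadratic K) (hD3 : NumberField.discr K ≠ -3)
    (hH : SatisfiesHeegnerHypothesis N K)
    (hopt : ∃ Dt : ModularParametrizationData W' N,
      ∀ z ∈ Dt.L.lattice, ∃ w ∈ periodLattice Dt.f, z = (Dt.c : ℂ) * w)
    {P : (W'.baseChange K).toAffine.Point} (hP : IsHeegnerPoint N W' K P) (hnt : ¬ IsOfFinAddOrder P)
    (hp2 : p ≠ 2) (hpN : ¬ p ∣ N) (hρ : W'.HasSurjectiveModNGaloisRep p)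
    (q : ℕ) [Fact q.Prime] (hqN : q ∣ N)
    (hle : padicValNat p (AddSubgroup.zmultiples P).index ≤
      padicValNat p ((W'.baseChange ℚ_[q]).localTamagawaNumber ℤ_[q]))
    (hr : W'.analyticRank ≤ 1) {s : ℚ} (hs : shaAn W' = (s : ℂ)) (hv : padicValRat p s = 0) :
    BSDp W p := by
  have h' : BSDp W' p := bsdp_of_jetchev_of_index_le_tamagawa W' p hJ hGZK hKo hK hD3 hH hopt hP hnt
    hp2 hpN hρ q hqN hle hr hs hv
  obtain ⟨-, hfin'⟩ := hGZK W' hr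
  haveI : Finite W'.sha := hfin'
  exact Wuthrich2014.bsdp_of_isIsogenous hCassels hiso hfin'
    (WeierstrassCurve.leadingLCoeff_ne_zero_holds (hmod W')) h'

end Literature.NumberTheory.EllipticCurves.Rank1Residual.Typed

end
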